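import Summits.ResolutionOfSingularities.ResolutionOfSingularities.Theorems.PurelyInseparableDim4ChartCentreEscape
import Summits.ResolutionOfSingularities.ResolutionOfSingularities.Theorems.PurelyInseparableDim4StepKitState
import HarnessLib

/-!
# Purely inseparable four-folds `z^p + F(x₁, …, x₄)`: the walk of record ESCAPES its chart already at depth 2 —
# a kernel certificate that «S3-glob» is not vacuous (brick (a) of the TY-2 chart dictionary, cell `res-dim4-pi`,
# typ-2 g3)

[OURS · counted 0 · certificate] (D-0157 DOOR 2; director-resolution DR-157-C; desk WORD #66 (4)(a), WORD #92 (b)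
rider «S3-glob … OPEN»). Over `K = 𝔽₂`, `p = q = 2`, variables `(x₁, x₂, x₃, x₄) = Fin 4`, take the clean state
`s₀ = (F = x₁x₂(x₃ + 1)²x₄ = x₁x₂x₃²x₄ + x₁x₂x₄, r = 0, exc = ∅)`. The MODE-1h walk of record (`PIDim4.Step1h`)
does, as certified by res-dim4-p-13's `StepKit` (`step1h_of … (by decide)`):

* depth 1: the MODE-1h centre is the surface `V(z, x₁, x₂)` (`ord_{(x₁,x₂)} F = 2`, no coordinate 3-fold is
  2-fold: `x₁`, `x₂`, `x₄` occur to the first power, `x₃` not in `x₁x₂x₄`); at the point `x₃ = 1` of the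
  `x₁`-chart (`b = (0, 0, 1, 0)`) the transform is `s₁ = (x₂x₃²x₄, 0, {x₁})` (`Step1h 2 s₀ s₁`,
  `step1h_escape₁`; `s₁ = CentreBlowup.step 2 {x₁,x₂} x₁ b s₀`, `step_escape₁`);
* depth 2: the MODE-1h centre of `s₁` is the 3-fold `V(z, x₃)` of the chart (`isMode1hCentre_escape₂`), and the walk
  goes on (`Step1h 2 s₁ s₂`, `s₂ = (x₂x₄, 0, {x₁, x₃})`, `step1h_escape₂`).

The second centre leaves the fibre variable `x₂` of the first chart FREE (`x₂ ∈ {x₁,x₂} ∖ {x₁}`, `x₂ ∉ {x₃}`), so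
by typ-2 g2's CENTRE ESCAPE (`not_isClosed_image_CΛ_chart`, valuative criterion) its image in ANY blowing up
`W₁ → 𝔸⁵` of `V(z, x₁, x₂)` under ANY re-centred `x₁`-chart `Spec Θ ≫ chartImm` (`Θ xₖ = xₖ + bₖ`) is NOT
CLOSED in `W₁` (`not_isClosed_escape₂`): **the walk's second centre is not the restriction of its own closure
taken inside the chart — a global centre for the second blow-up must be chosen by a rule the walk does not
contain («S3-glob», FC-2)** — `exists_step1h_chain_escaping` packages the record. (By hand, not certified here:
the closure is the strict transform of the far 2-fold component `V(z, x₃ + 1)` of `Sing₂`, regular and inside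
`Sing₂` of the transform, so closure happens to be an admissible global centre in THIS instance.) By typ-2 g3's
brick (b) (`exists_lsb_of_chain_step1h`) the same chain IS a local sequence of blow-ups — the LSB format does not
see the escape. Nothing here proves resolution of singularities in dimension ≥ 4 / characteristic `p` — NOT proved
anywhere in this programme. AI-produced formalisation, weaker than expert review.
bears_on: LADDER-RESOLUTION:D157-DOOR2 (res-dim4-pi · S3 (a) escape certificate / S3-glob).
-/

set_option linter.dupNamespace false -- D-0017: single-problem summit path `Summit.<S>.<S>.…` by design

noncomputable section

open MvPolynomial Finset CategoryTheory AlgebraicGeometry Opposite TopologicalSpace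

namespace Summit.ResolutionOfSingularities.ResolutionOfSingularities.Theorems.PIDim4

open Literature.AlgebraicGeometry.Resolution
open Literature.AlgebraicGeometry.Resolution.AffinePointBlowup (P A γ coord Wtop)
open StepKit

namespace ChartDictionary

/-! ## §1 The two MODE-1h steps, certified by the StepKit -/

/-- **Depth 1.** From `s₀ = (x₁x₂x₃²x₄ + x₁x₂x₄, 0, ∅)` over `𝔽₂`: MODE-1h centre `V(z, x₁, x₂)`, `x₁`-chart, point
`b = (0,0,1,0)`, transform `s₁ = (x₂x₃²x₄, 0, {x₁})` — a `Step1h 2` edge. [folklore] -/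
theorem step1h_escape₁ :
    Step1h 2 (⟨[(![1, 1, 2, 1], 1), (![1, 1, 0, 1], 1)], ![0, 0, 0, 0], ∅⟩ : SData 4 (ZMod 2)).toState
      (⟨[(![0, 1, 2, 1], 1)], ![0, 0, 0, 0], {0}⟩ : SData 4 (ZMod 2)).toState :=
  step1h_of {0, 1} 0 ![0, 0, 1, 0] (by decide) (by decide) (by decide) (by decide) (by decide) (by decide)

/-- The depth-1 centre `{x₁, x₂}` IS the MODE-1h centre of `s₀` (Hironaka-permissible, and no coordinate 3-fold
is). [folklore] -/
theorem isMode1hCentre_escape₁ :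
    IsMode1hCentre 2 ({0, 1} : Finset (Fin 4))
      (⟨[(![1, 1, 2, 1], 1), (![1, 1, 0, 1], 1)], ![0, 0, 0, 0], ∅⟩ : SData 4 (ZMod 2)).toState.F :=
  (isMode1hCentre_iff 2 {0, 1} _).mpr (by decide)

/-- `s₁` IS the tree's `CentreBlowup.step` of `s₀` at `({x₁,x₂}, x₁, b = (0,0,1,0))` — the datum the chart
dictionary reads (`controlledTransform_chart_eq_step`). [folklore] -/
theorem step_escape₁ :
    CentreBlowup.step 2 ({0, 1} : Finset (Fin 4)) 0 (![0, 0, 1, 0] : Fin 4 → ZMod 2)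
        (⟨[(![1, 1, 2, 1], 1), (![1, 1, 0, 1], 1)], ![0, 0, 0, 0], ∅⟩ : SData 4 (ZMod 2)).toState =
      (⟨[(![0, 1, 2, 1], 1)], ![0, 0, 0, 0], {0}⟩ : SData 4 (ZMod 2)).toState :=
  (step_eq_iff 2 {0, 1} 0 ![0, 0, 1, 0] _ _).mpr (by decide)

/-- **Depth 2.** The MODE-1h centre of `s₁ = (x₂x₃²x₄, 0, {x₁})` is the 3-fold `V(z, x₃)` of the chart
(`ord_{(x₃)} = 2`; least cardinality `1`). [folklore] -/
theorem isMode1hCentre_escape₂ :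
    IsMode1hCentre 2 ({2} : Finset (Fin 4))
      (⟨[(![0, 1, 2, 1], 1)], ![0, 0, 0, 0], {0}⟩ : SData 4 (ZMod 2)).toState.F :=
  (isMode1hCentre_iff 2 {2} _).mpr (by decide)

/-- **Depth 2, the walk goes on**: `x₃`-chart, origin, transform `s₂ = (x₂x₄, 0, {x₁, x₃})` — a second
`Step1h 2` edge. [folklore] -/
theorem step1h_escape₂ :
    Step1h 2 (⟨[(![0, 1, 2, 1], 1)], ![0, 0, 0, 0], {0}⟩ : SData 4 (ZMod 2)).toState
      (⟨[(![0, 1, 0, 1], 1)], ![0, 0, 0, 0], {0, 2}⟩ : SData 4 (ZMod 2)).toState :=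
  step1h_of {2} 2 ![0, 0, 0, 0] (by decide) (by decide) (by decide) (by decide) (by decide) (by decide)

/-! ## §2 The second centre escapes the first chart -/

/-- **ESCAPE AT DEPTH 2.** For ANY blowing up `π : W₁ → 𝔸⁵_{𝔽₂}` along `V(z, x₁, x₂)` and ANY re-centring
`Θ` of the `x₁`-chart at `b = (0,0,1,0)` (`Θ xₖ = xₖ + bₖ`; `Θ z` arbitrary, e.g. the cleaning), the image of
the walk's second centre `V(z, x₃)` under `Spec Θ ≫ chartImm : 𝔸⁵ ⟶ W₁` is NOT closed in `W₁` (the fibre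
variable `x₂` is free on it: typ-2 g2's `not_isClosed_image_CΛ_chart`). [cite: GortzWedhorn2020, Thm. 15.9]
[cite: Hauser2010, §§F–G] -/
theorem not_isClosed_escape₂ {W : Scheme.{0}} {π : W ⟶ P 4 (ZMod 2)}
    (hπ : IsBlowup π (AffineCoordBlowup.𝓘Λ 4 (ZMod 2)
      (insert 0 (Fin.succ '' ((({0, 1} : Finset (Fin 4)) : Set (Fin 4)))))))
    {Θ : A 4 (ZMod 2) ≃ₐ[ZMod 2] A 4 (ZMod 2)}
    (hs : ∀ k : Fin 4, Θ (X k.succ) = X k.succ + C ((![0, 0, 1, 0] : Fin 4 → ZMod 2) k)) :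
    ¬ IsClosed ((Spec.map (CommRingCat.ofHom (Θ : A 4 (ZMod 2) →+* A 4 (ZMod 2))) ≫
        AffineCoordBlowup.chartImm hπ (succ_mem_centreVars
          (show (0 : Fin 4) ∈ ({0, 1} : Finset (Fin 4)) by decide))) ''
      (AffineCoordBlowup.CΛ 4 (ZMod 2) (insert 0 (Fin.succ '' ((({2} : Finset (Fin 4))) : Set (Fin 4)))) :
        Set (P 4 (ZMod 2)))) :=
  not_isClosed_image_CΛ_chart (i := 1) (by decide) (by decide) hs hπ (by decide) (by decide) (by decide)

/-- **RECORD: the MODE-1h walk escapes its chart at depth 2 (p = 2).** There are states `s₀ → s₁ → s₂` of the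
walk of record over `𝔽₂` (`Step1h 2` twice) such that `s₁` is the step of `s₀` at the MODE-1h centre
`V(z, x₁, x₂)`, chart `x₁`, point `b = (0,0,1,0)`, the MODE-1h centre of `s₁` is `V(z, x₃)`, and for every
blowing up `W₁ → 𝔸⁵` of `V(z, x₁, x₂)` and every re-centred `x₁`-chart at `b` the image of `V(z, x₃)` in `W₁` is
not closed: the next centre of the walk is NOT cut out on the chart by a closed subset of `W₁` («S3-glob» /
FC-2 is a genuine obligation, not vacuous). [cite: GortzWedhorn2020, Thm. 15.9] [cite: Hauser2010, §§F–G] -/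
theorem exists_step1h_chain_escaping :
    ∃ s₀ s₁ s₂ : State (ZMod 2), Step1h 2 s₀ s₁ ∧ Step1h 2 s₁ s₂ ∧
      IsMode1hCentre 2 ({0, 1} : Finset (Fin 4)) s₀.F ∧
      s₁ = CentreBlowup.step 2 ({0, 1} : Finset (Fin 4)) 0 (![0, 0, 1, 0] : Fin 4 → ZMod 2) s₀ ∧
      IsMode1hCentre 2 ({2} : Finset (Fin 4)) s₁.F ∧
      ∀ {W : Scheme.{0}} {π : W ⟶ P 4 (ZMod 2)}
        (hπ : IsBlowup π (AffineCoordBlowup.𝓘Λ 4 (ZMod 2)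
          (insert 0 (Fin.succ '' ((({0, 1} : Finset (Fin 4)) : Set (Fin 4)))))))
        {Θ : A 4 (ZMod 2) ≃ₐ[ZMod 2] A 4 (ZMod 2)},
        (∀ k : Fin 4, Θ (X k.succ) = X k.succ + C ((![0, 0, 1, 0] : Fin 4 → ZMod 2) k)) →
        ¬ IsClosed ((Spec.map (CommRingCat.ofHom (Θ : A 4 (ZMod 2) →+* A 4 (ZMod 2))) ≫
            AffineCoordBlowup.chartImm hπ (succ_mem_centreVars
              (show (0 : Fin 4) ∈ ({0, 1} : Finset (Fin 4)) by decide))) ''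
          (AffineCoordBlowup.CΛ 4 (ZMod 2) (insert 0 (Fin.succ '' ((({2} : Finset (Fin 4))) : Set (Fin 4)))) :
            Set (P 4 (ZMod 2)))) :=
  ⟨_, _, _, step1h_escape₁, step1h_escape₂, isMode1hCentre_escape₁, step_escape₁.symm, isMode1hCentre_escape₂,
    fun hπ _ hs => not_isClosed_escape₂ hπ hs⟩

/-! ## §3 The `p = 3` twin: `F = x₁x₂²(x₃+1)³x₄` over `𝔽₃` (APPEND, typ-2 g3) -/

/-- **Depth 1, `p = 3`.** From `s₀ = (x₁x₂²x₃³x₄ + x₁x₂²x₄, 0, ∅)` over `𝔽₃` (`= x₁x₂²(x₃+1)³x₄`): MODE-1h centre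
`V(z, x₁, x₂)` (`ord = 1 + 2 = 3`), `x₁`-chart, point `b = (0,0,−1,0)`, transform `s₁ = (x₂²x₃³x₄, 0, {x₁})` — a
`Step1h 3` edge. [folklore] -/
theorem step1h_escape₁_three :
    Step1h 3 (⟨[(![1, 2, 3, 1], 1), (![1, 2, 0, 1], 1)], ![0, 0, 0, 0], ∅⟩ : SData 4 (ZMod 3)).toState
      (⟨[(![0, 2, 3, 1], 1)], ![0, 0, 0, 0], {0}⟩ : SData 4 (ZMod 3)).toState :=
  step1h_of {0, 1} 0 ![0, 0, 2, 0] (by decide) (by decide) (by decide) (by decide) (by decide) (by decide)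

/-- `s₁` is the tree's `CentreBlowup.step` of `s₀` at `({x₁,x₂}, x₁, b = (0,0,−1,0))`, `p = 3`. [folklore] -/
theorem step_escape₁_three :
    CentreBlowup.step 3 ({0, 1} : Finset (Fin 4)) 0 (![0, 0, 2, 0] : Fin 4 → ZMod 3)
        (⟨[(![1, 2, 3, 1], 1), (![1, 2, 0, 1], 1)], ![0, 0, 0, 0], ∅⟩ : SData 4 (ZMod 3)).toState =
      (⟨[(![0, 2, 3, 1], 1)], ![0, 0, 0, 0], {0}⟩ : SData 4 (ZMod 3)).toState :=
  (step_eq_iff 3 {0, 1} 0 ![0, 0, 2, 0] _ _).mpr (by decide)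

/-- **Depth 2, `p = 3`.** The MODE-1h centre of `s₁ = (x₂²x₃³x₄, 0, {x₁})` is `V(z, x₃)`. [folklore] -/
theorem isMode1hCentre_escape₂_three :
    IsMode1hCentre 3 ({2} : Finset (Fin 4))
      (⟨[(![0, 2, 3, 1], 1)], ![0, 0, 0, 0], {0}⟩ : SData 4 (ZMod 3)).toState.F :=
  (isMode1hCentre_iff 3 {2} _).mpr (by decide)

/-- **Depth 2, `p = 3`, the walk goes on**: `x₃`-chart, origin, `s₂ = (x₂²x₄, 0, {x₁, x₃})`. [folklore] -/
theorem step1h_escape₂_three :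
    Step1h 3 (⟨[(![0, 2, 3, 1], 1)], ![0, 0, 0, 0], {0}⟩ : SData 4 (ZMod 3)).toState
      (⟨[(![0, 2, 0, 1], 1)], ![0, 0, 0, 0], {0, 2}⟩ : SData 4 (ZMod 3)).toState :=
  step1h_of {2} 2 ![0, 0, 0, 0] (by decide) (by decide) (by decide) (by decide) (by decide) (by decide)

/-- **ESCAPE AT DEPTH 2, `p = 3`.** For ANY blowing up of `𝔸⁵_{𝔽₃}` along `V(z, x₁, x₂)` and ANY re-centring of
the `x₁`-chart at `b = (0,0,−1,0)`, the image of `V(z, x₃)` is NOT closed in `W₁` (fibre variable `x₂` free).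
[cite: GortzWedhorn2020, Thm. 15.9] [cite: Hauser2010, §§F–G] -/
theorem not_isClosed_escape₂_three {W : Scheme.{0}} {π : W ⟶ P 4 (ZMod 3)}
    (hπ : IsBlowup π (AffineCoordBlowup.𝓘Λ 4 (ZMod 3)
      (insert 0 (Fin.succ '' ((({0, 1} : Finset (Fin 4)) : Set (Fin 4)))))))
    {Θ : A 4 (ZMod 3) ≃ₐ[ZMod 3] A 4 (ZMod 3)}
    (hs : ∀ k : Fin 4, Θ (X k.succ) = X k.succ + C ((![0, 0, 2, 0] : Fin 4 → ZMod 3) k)) :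
    ¬ IsClosed ((Spec.map (CommRingCat.ofHom (Θ : A 4 (ZMod 3) →+* A 4 (ZMod 3))) ≫
        AffineCoordBlowup.chartImm hπ (succ_mem_centreVars
          (show (0 : Fin 4) ∈ ({0, 1} : Finset (Fin 4)) by decide))) ''
      (AffineCoordBlowup.CΛ 4 (ZMod 3) (insert 0 (Fin.succ '' ((({2} : Finset (Fin 4))) : Set (Fin 4)))) :
        Set (P 4 (ZMod 3)))) :=
  not_isClosed_image_CΛ_chart (i := 1) (by decide) (by decide) hs hπ (by decide) (by decide) (by decide)

/-- **RECORD, `p = 3`: the MODE-1h walk over `𝔽₃` escapes its chart at depth 2** (same shape as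
`exists_step1h_chain_escaping`; the phenomenon is not a `p = 2` artefact). [cite: GortzWedhorn2020, Thm. 15.9]
[cite: Hauser2010, §§F–G] -/
theorem exists_step1h_chain_escaping_three :
    ∃ s₀ s₁ s₂ : State (ZMod 3), Step1h 3 s₀ s₁ ∧ Step1h 3 s₁ s₂ ∧
      s₁ = CentreBlowup.step 3 ({0, 1} : Finset (Fin 4)) 0 (![0, 0, 2, 0] : Fin 4 → ZMod 3) s₀ ∧
      IsMode1hCentre 3 ({2} : Finset (Fin 4)) s₁.F ∧
      ∀ {W : Scheme.{0}} {π : W ⟶ P 4 (ZMod 3)}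
        (hπ : IsBlowup π (AffineCoordBlowup.𝓘Λ 4 (ZMod 3)
          (insert 0 (Fin.succ '' ((({0, 1} : Finset (Fin 4)) : Set (Fin 4)))))))
        {Θ : A 4 (ZMod 3) ≃ₐ[ZMod 3] A 4 (ZMod 3)},
        (∀ k : Fin 4, Θ (X k.succ) = X k.succ + C ((![0, 0, 2, 0] : Fin 4 → ZMod 3) k)) →
        ¬ IsClosed ((Spec.map (CommRingCat.ofHom (Θ : A 4 (ZMod 3) →+* A 4 (ZMod 3))) ≫
            AffineCoordBlowup.chartImm hπ (succ_mem_centreVars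
              (show (0 : Fin 4) ∈ ({0, 1} : Finset (Fin 4)) by decide))) ''
          (AffineCoordBlowup.CΛ 4 (ZMod 3) (insert 0 (Fin.succ '' ((({2} : Finset (Fin 4))) : Set (Fin 4)))) :
            Set (P 4 (ZMod 3)))) :=
  ⟨_, _, _, step1h_escape₁_three, step1h_escape₂_three, step_escape₁_three.symm, isMode1hCentre_escape₂_three,
    fun hπ _ hs => not_isClosed_escape₂_three hπ hs⟩

end ChartDictionary

end Summit.ResolutionOfSingularities.ResolutionOfSingularities.Theorems.PIDim4

end
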